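import Summits.HodgeConjecture.HodgeConjecture.Theorems.NikulinTwinTransportTwinSimilitudeAlgebraicStubAnchorForward
import Summits.HodgeConjecture.HodgeConjecture.Theorems.NikulinTwinTransportHodgeSimilitudeAlgebraicCmSelfSimilitude
import Literature.AlgebraicGeometry.Surfaces.K3ComplexMultiplication
import Literature.AlgebraicGeometry.Surfaces.K3HodgeTypesHolds
import Literature.NumberTheory.Transcendental.DeRhamTheoremMultiplicative
import HarnessLib

/-!
# Route NikulinTwinTransport · crux X = `TwinSimilitudeAlgebraic` (stmt-HodgeConjecture-13674) —
# A CM-NORM-2 K3 SURFACE IS ITS OWN ALGEBRAIC `2`-ANCHOR (line `hyperkaehler-nikulin-anchors`, reshape r9, lead c5)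

The line proves X (every rational, type-preserving `2`-similitude `ψ : H²(S′(ℂ); ℂ) → H²(S(ℂ); ℂ)` between
projective K3 surfaces is `fst_*(snd^* – ∪ γ)` for an algebraic `γ` on `S × S′`) from ONE algebraic anchor
`2`-similitude per surface (`simAlg_at_of_outAnchor`, `simAlg_at_of_outAnchor_target`), and builds anchors on
the HK-Nikulin sector (rank `T ≤ 14`).  This file supplies the one anchor mechanism NOT bounded by the rank of
`T`: COMPLEX MULTIPLICATION.

* `CMNorm2[S, p]` (local notation): `H²(S(ℂ); ℂ)` carries a RATIONAL `2`-SELF-SIMILITUDE `e`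
  (`(x.y) = a·p ⟹ (ex.ey) = 2a·p`) acting on a non-zero `(2,0)`-class by a NON-REAL scalar `t`.  For a
  projective K3 surface: `E = End_Hdg(T(S)_ℚ)` is a CM field (Zarhin) containing an element of relative
  norm `e·ē = 2` (e.g. every CM field containing `i`, `(1+i)(1−i) = 2`; a `2`-similitude of `T_ℚ` extends
  to `H²_ℚ` by Witt cancellation, `Λ_ℚ(2) ≅ Λ_ℚ`).  Such surfaces exist at every even rank of `T` up to `20`
  (Kondō's surface with a purely non-symplectic automorphism of order `44`: `E = ℚ(ζ₄₄) ∋ i`, rank `T = 20`).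
* `cmNorm_markingConj` — through a marking `(η, p₀, x₀)` the conjugate `J = η e η⁻¹` is defined over `ℚ`,
  doubles the K3 form and has the period `x₀` as `t`-eigenvector; `cmNorm_typePreserving` — hence `e` is
  type-preserving (`isOfHodgeType_markingConj`); `hasComplexMultiplication_of_cmNorm` — and `S` is CM.
* `outAnchor_self_of_cmNorm` — **THE SELF-ANCHOR**: `OutAnchor[μ, S, S, hS, hS, p, p]` with `Ψ := e`: `e` is
  bijective (a similitude of the non-degenerate K3 form, `k3Form_eq_zero_of_forall`), ALGEBRAIC —
  `e = [γ_e]_*`, `γ_e ∈ N²H⁴(S × S)`, by the landed anchor theorem `CmNormAnchors.stub_cmSelfSimilitude_algebraic`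
  (Buskin's CM corollary `Buskin2019_hodgeConjectureFor_square_of_CM`; de Rham's theorem and the Hodge types of
  `H²(K3)` are theorems of the tree) — and `e⁻¹` is rational, type-preserving and HALVES the cup form: the
  equivalence `Φ` with `Φ⁻¹ = ½e` has a rational, type-preserving, halving inverse, so `Φ = 2e⁻¹` is rational,
  type-preserving and doubling (`stub_anchorForward`), i.e. `e⁻¹ = ½Φ` is as claimed.

Consumer: `Theorems/NikulinTwinTransportTwinSimilitudeAlgebraicCMNormTwins.lean` (X at every pair with a
CM-norm-2 twin; the r9 residual).  No definitions, no new named facts, no `sorry`.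

## References

* [Buskin2019] N. Buskin, J. reine angew. Math. 755 (2019), Thm. 1.1, Corollary (Introduction), §6.2.
* [Huybrechts2019] D. Huybrechts, Comment. Math. Helv. 94 (2019), Cor. 0.4 (ii) and Rem. 3.3.
* [Huybrechts2016K3] D. Huybrechts, Lectures on K3 Surfaces, CUP 2016, Ch. 3 Cor. 3.6, Thm. 3.7, Rem. 3.10;
  Ch. 6 Prop. 1.2; Ch. 14 §0.3 (vi); Ch. 15 §1.
* [Zarhin1983HodgeGroupsK3] Yu. G. Zarhin, J. reine angew. Math. 341 (1983), Thm. 1.5.1 and §2.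
-/

noncomputable section

set_option linter.dupNamespace false

open CategoryTheory MonoidalCategory
open scoped Manifold Matrix
open Literature.AlgebraicGeometry.Motives Literature.AlgebraicGeometry.HodgeTheory
open Literature.AlgebraicGeometry.Surfaces Literature.Geometry.Kaehler
open Literature.AlgebraicTopology.SingularHomology
open Literature.NumberTheory.Transcendental (exists_deRhamIsoFamily exists_deRhamIsoFamily_holds)
open Summit.HodgeConjecture.HodgeConjecture.Theses.NikulinTwinTransport

namespace Summit.HodgeConjecture.HodgeConjecture.Theorems.NikulinTwinTransport

/-! ## Local notations (verbatim those of the route's Theorems files) -/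

/-- `Gen[S, p]`: `p` is an integral generator of `H⁴(S(ℂ); ℂ)` (the generator clause of X). Local notation
only. -/
local notation3 (prettyPrint := false) "Gen[" S ", " p "]" =>
  (IsIntegralClass p ∧ ∀ q : complexBetti S (2 * 2), IsIntegralClass q → ∃ n : ℤ, q = n • p)

/-- `Corr[μ, S, S', hS, hS' ; γ, y] = [γ]_* y = fst_*(snd^* y ∪ γ)`, the action of
`γ ∈ H⁴((S ⊗ S′)(ℂ); ℂ)` as a correspondence `H²(S′) → H²(S)` (the FIRST factor receives). Local notation
only, verbatim from the route's Theorems files. -/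
local notation3 (prettyPrint := false) "Corr[" μ ", " S ", " S' ", " hS ", " hS' " ; " γ ", " y "]" =>
  complexGysin μ
    (IsSmoothProjective.tensor_holds (IsK3Surface.isSmoothProjective hS)
      (IsK3Surface.isSmoothProjective hS'))
    (IsK3Surface.isSmoothProjective hS) (SemiCartesianMonoidalCategory.fst S S')
    (rfl : 2 * 1 + 2 * 2 + 2 * 2 = 2 * 1 + 2 * (2 + 2))
    (cupProduct (rfl : 2 * 1 + 2 * 2 = 2 * 1 + 2 * 2)
      (complexBetti.map (SemiCartesianMonoidalCategory.snd S S') (2 * 1) y) γ)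

/-- `OutAnchor[μ, S, Sg, hS, hSg, p, pg]`: an algebraic OUT-anchor `2`-similitude at `S` with partner `Sg`
(verbatim the notation of `…HKSectorTheorem` / `…HKTargetTheorem`). Local notation only. -/
local notation3 (prettyPrint := false)
    "OutAnchor[" μ ", " S ", " Sg ", " hS ", " hSg ", " p ", " pg "]" =>
  ∃ Ψ : complexBetti S (2 * 1) ≃ₗ[ℂ] complexBetti Sg (2 * 1),
    (∀ y, IsRationalClass y → IsRationalClass (Ψ.symm y)) ∧
    (∀ (i j : ℕ) y, IsOfHodgeType 2 Sg (2 * 1) i j y →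
      IsOfHodgeType 2 S (2 * 1) i j (Ψ.symm y)) ∧
    (∀ (u v : complexBetti Sg (2 * 1)) (b : ℂ),
      cupProduct (rfl : 2 * 1 + 2 * 1 = 2 * 2) u v = ((2 : ℂ) * b) • pg →
        cupProduct (rfl : 2 * 1 + 2 * 1 = 2 * 2) (Ψ.symm u) (Ψ.symm v) = b • p) ∧
    ∃ γ ∈ algebraicClasses (MonoidalCategoryStruct.tensorObj Sg S) 2,
      ∀ x : complexBetti S (2 * 1), Ψ x = Corr[μ, Sg, S, hSg, hS ; γ, x]

/-- `CMNorm2[S, p]`: **`S` is CM-norm-2** — `H²(S(ℂ); ℂ)` carries a rational `2`-self-similitude `e`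
(`(x.y) = a·p ⟹ (ex.ey) = 2a·p`, `p` the chosen generator of `H⁴`) acting on a non-zero `(2,0)`-class by a
non-real scalar.  For a projective K3 surface: `End_Hdg(T(S)_ℚ)` is a CM field containing an element of
relative norm `2` (Zarhin; Huybrechts Ch. 3 Thm. 3.7); in particular `HasComplexMultiplication S`
(`hasComplexMultiplication_of_cmNorm`). Local notation only.
[cite: Huybrechts2016K3, Ch. 3 Thm. 3.7 and Rem. 3.10] [cite: Zarhin1983HodgeGroupsK3, Thm. 1.5.1] -/
local notation3 (prettyPrint := false) "CMNorm2[" S ", " p "]" =>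
  ∃ e : complexBetti S (2 * 1) →ₗ[ℂ] complexBetti S (2 * 1),
    (∀ x, IsRationalClass x → IsRationalClass (e x)) ∧
    (∀ (x y : complexBetti S (2 * 1)) (a : ℂ),
      cupProduct (rfl : 2 * 1 + 2 * 1 = 2 * 2) x y = a • p →
        cupProduct (rfl : 2 * 1 + 2 * 1 = 2 * 2) (e x) (e y) = ((2 : ℂ) * a) • p) ∧
    ∃ (σ : complexBetti S (2 * 1)) (t : ℂ), IsOfHodgeType 2 S (2 * 1) 2 0 σ ∧ σ ≠ 0 ∧ t.im ≠ 0 ∧ e σ = t • σ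

/-- `MarkedK3[S, η, p, x]`: a marked K3 surface with period `x` (the six marking clauses of the named fact
`Huybrechts_K3_marking_exists`). Local notation only, verbatim from the route's Theorems files. -/
local notation3 (prettyPrint := false) "MarkedK3[" S ", " η ", " p ", " x "]" =>
  (IsIntegralClass p ∧
    (∀ q : complexBetti S (2 * 2), IsIntegralClass q → ∃ n : ℤ, q = n • p) ∧
    (∀ c : complexBetti S (2 * 1), IsIntegralClass c ↔ ∃ v : K3Index → ℤ, η c = fun i => (v i : ℂ)) ∧
    (∀ a b : complexBetti S (2 * 1),
        cupProduct (rfl : 2 * 1 + 2 * 1 = 2 * 2) a b = k3Form (η a) (η b) • p) ∧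
    IsOfHodgeType 2 S (2 * 1) 2 0 (LinearEquiv.symm η x) ∧
    (∀ τ : complexBetti S (2 * 1), IsOfHodgeType 2 S (2 * 1) 2 0 τ → ∃ t : ℂ, τ = t • LinearEquiv.symm η x))

/-- `PeriodPt[x]`: `(x.x) = 0`, `(x̄.x) > 0`, a positive lattice vector in `x^⊥`. Local notation only,
verbatim from the route's Theorems files. -/
local notation3 (prettyPrint := false) "PeriodPt[" x "]" =>
  (k3Form x x = 0 ∧ 0 < (k3Form (star x) x).re ∧
    ∃ u : K3Index → ℤ, k3Form (fun i => (u i : ℂ)) x = 0 ∧ 0 < ∑ i, ∑ j, u i * k3Gram i j * u j)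

/-- `RatEnd[J]`: the endomorphism `J` of `Λ_ℂ` is defined over `ℚ`. Local notation only, verbatim from the
route's Theorems files. -/
local notation3 (prettyPrint := false) "RatEnd[" J "]" =>
  ∀ v : K3Index → ℤ, ∃ w : K3Index → ℚ, J (fun i => (v i : ℂ)) = fun i => (w i : ℂ)

/-! ## The complex K3 form is non-degenerate -/

/-- **The complex K3 form is non-degenerate** (`det Λ_{K3} = −1`): a vector orthogonal to all of `Λ_ℂ`
is zero. [cite: Huybrechts2016K3, Ch. 14 §0.3 (vi)] -/
theorem k3Form_eq_zero_of_forall {a : K3Index → ℂ} (h : ∀ b, k3Form a b = 0) : a = 0 := by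
  have hnd : (k3FormC).Nondegenerate := by
    refine LinearMap.BilinForm.nondegenerate_toBilin'_of_det_ne_zero' _ ?_
    have hdet : (k3Gram.map (Int.cast : ℤ → ℂ)).det = ((k3Gram.det : ℤ) : ℂ) := (Int.cast_det k3Gram).symm
    rw [hdet, k3Gram_det]
    norm_num
  exact hnd.1 a fun b => by rw [k3FormC_apply]; exact h b

/-! ## Marked form of a CM-norm-2 structure -/

/-- **A CM-norm-2 structure read through a marking.**  Given a marking `(η, p₀, x₀)` of the projective K3
surface `S` (the data of `Huybrechts_K3_marking_exists`) and a rational `2`-self-similitude `e` of `H²(S)`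
(for the generator `p`) with `e σ = t σ` on a non-zero `(2,0)`-class, the conjugate
`J := η ∘ e ∘ η⁻¹` is an endomorphism of `Λ_ℂ` defined over `ℚ` (`markingConj_intCast`), multiplies the K3
form by `2` (`k3Form_markingConj_signed_mul`; the two generators `p`, `p₀` differ by inverse integer
factors) and has the period `x₀` as an eigenvector with the same eigenvalue `t` (`H^{2,0} = ℂ·η⁻¹x₀`).
[cite: Buskin2019, §6.2 (markings)] [cite: Huybrechts2016K3, Ch. 3 Cor. 3.6] -/
theorem cmNorm_markingConj {S : SchemeOver ℂ} (hS : IsK3Surface S) {p : complexBetti S (2 * 2)}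
    (hp : Gen[S, p]) (η : complexBetti S (2 * 1) ≃ₗ[ℂ] (K3Index → ℂ)) (p₀ : complexBetti S (2 * 2))
    (x₀ : K3Index → ℂ) (hm : MarkedK3[S, η, p₀, x₀])
    (e : complexBetti S (2 * 1) →ₗ[ℂ] complexBetti S (2 * 1))
    (he_rat : ∀ x, IsRationalClass x → IsRationalClass (e x))
    (he_sim : ∀ (x y : complexBetti S (2 * 1)) (a : ℂ),
      cupProduct (rfl : 2 * 1 + 2 * 1 = 2 * 2) x y = a • p →
        cupProduct (rfl : 2 * 1 + 2 * 1 = 2 * 2) (e x) (e y) = ((2 : ℂ) * a) • p)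
    {σ : complexBetti S (2 * 1)} {t : ℂ} (hσ : IsOfHodgeType 2 S (2 * 1) 2 0 σ) (hσ0 : σ ≠ 0)
    (heσ : e σ = t • σ) :
    RatEnd[η.toLinearMap ∘ₗ e ∘ₗ η.symm.toLinearMap] ∧
      (∀ a b, k3Form ((η.toLinearMap ∘ₗ e ∘ₗ η.symm.toLinearMap) a)
        ((η.toLinearMap ∘ₗ e ∘ₗ η.symm.toLinearMap) b) = 2 * k3Form a b) ∧
      (η.toLinearMap ∘ₗ e ∘ₗ η.symm.toLinearMap) x₀ = t • x₀ ∧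
      (∀ y, η.symm ((η.toLinearMap ∘ₗ e ∘ₗ η.symm.toLinearMap) (η y)) = e y) := by
  obtain ⟨hp₀int, hgen₀, hint, hcup, h20, huniq⟩ := hm
  have hp0 : p ≠ 0 := generator_ne_zero hS hp.2
  have hp₀0 : p₀ ≠ 0 := generator_ne_zero hS hgen₀
  -- the two generators: `p = m • p₀`, `p₀ = n • p`, `m n = 1`
  obtain ⟨m, hm⟩ := hgen₀ p hp.1
  obtain ⟨n, hn⟩ := hp.2 p₀ hp₀int
  rw [← Int.cast_smul_eq_zsmul ℂ] at hm hn
  have hmn : (n : ℂ) * (m : ℂ) = 1 := by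
    have h1 : p = ((m : ℂ) * (n : ℂ)) • p := by
      conv_lhs => rw [hm, hn, smul_smul]
    have h2 : ((m : ℂ) * (n : ℂ) - 1) • p = 0 := by rw [sub_smul, one_smul, ← h1, sub_self]
    rw [smul_eq_zero] at h2
    rcases h2 with h2 | h2
    · rw [mul_comm]; exact (sub_eq_zero.1 h2)
    · exact absurd h2 hp0
  refine ⟨?_, ?_, ?_, ?_⟩
  · exact markingConj_intCast hS η hint η hint e he_rat
  · intro a b
    rw [k3Form_markingConj_signed_mul η p₀ p hp₀0 (m : ℂ) hm hcup η p₀ p (n : ℂ) hn hcup 2 e he_sim a b,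
      hmn, one_mul]
  · -- the period is an eigenvector: `σ = s₀ • η⁻¹ x₀`
    obtain ⟨s₀, hs₀⟩ := huniq σ hσ
    have hs₀0 : s₀ ≠ 0 := by
      rintro rfl
      rw [zero_smul] at hs₀
      exact hσ0 hs₀
    have hησ : η.symm x₀ = s₀⁻¹ • σ := by
      rw [hs₀, smul_smul, inv_mul_cancel₀ hs₀0, one_smul]
    simp only [LinearMap.coe_comp, LinearEquiv.coe_coe, Function.comp_apply]
    rw [hησ, map_smul, heσ, smul_smul, map_smul, hs₀, map_smul, LinearEquiv.apply_symm_apply, smul_smul,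
      mul_right_comm, inv_mul_cancel₀ hs₀0, one_mul]
  · intro y
    simp only [LinearMap.coe_comp, LinearEquiv.coe_coe, Function.comp_apply,
      LinearEquiv.symm_apply_apply]

/-- **A rational `2`-self-similitude with a `(2,0)`-eigenclass is type-preserving** (it carries the period
line `H^{2,0} = ℂσ` to itself, hence — markings and `e` being real — `H^{0,2} = ℂσ̄` to itself, and
`H^{1,1} = ⟨σ, σ̄⟩^⊥` to itself since it preserves orthogonality; `isOfHodgeType_markingConj`), granted a
marking of `S`. [cite: Huybrechts2016K3, Ch. 6 Prop. 1.2] [cite: Buskin2019, §6.2] -/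
theorem cmNorm_typePreserving (hmk : Huybrechts_K3_marking_exists) {S : SchemeOver ℂ}
    (hS : IsK3Surface S) {p : complexBetti S (2 * 2)} (hp : Gen[S, p])
    (e : complexBetti S (2 * 1) →ₗ[ℂ] complexBetti S (2 * 1))
    (he_rat : ∀ x, IsRationalClass x → IsRationalClass (e x))
    (he_sim : ∀ (x y : complexBetti S (2 * 1)) (a : ℂ),
      cupProduct (rfl : 2 * 1 + 2 * 1 = 2 * 2) x y = a • p →
        cupProduct (rfl : 2 * 1 + 2 * 1 = 2 * 2) (e x) (e y) = ((2 : ℂ) * a) • p)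
    {σ : complexBetti S (2 * 1)} {t : ℂ} (hσ : IsOfHodgeType 2 S (2 * 1) 2 0 σ) (hσ0 : σ ≠ 0)
    (heσ : e σ = t • σ) :
    ∀ (i j : ℕ) x, IsOfHodgeType 2 S (2 * 1) i j x → IsOfHodgeType 2 S (2 * 1) i j (e x) := by
  obtain ⟨η, p₀, x₀, hp₀0, hm, hx⟩ := hmk S hS
  obtain ⟨hJrat, hJ2, hJx, hJe⟩ := cmNorm_markingConj hS hp η p₀ x₀ hm e he_rat he_sim hσ hσ0 heσ
  obtain ⟨-, -, hint, hcup, h20, -⟩ := hm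
  obtain ⟨-, hxpos, -⟩ := hx
  intro i j x hx'
  rw [← hJe x]
  exact isOfHodgeType_markingConj η p₀ x₀ η p₀ x₀ _ Huybrechts_K3_hodgeTypes_H2_holds hS hS hint hcup h20
    hxpos hint hcup hp₀0 h20 hxpos hJrat (two_ne_zero' ℂ) hJ2 ⟨t, hJx⟩ i j x hx'

/-- **A CM-norm-2 surface has complex multiplication** in the sense of the tree
(`HasComplexMultiplication`: a rational, type-preserving endomorphism of `H²` with a non-real eigenvalue on
a non-zero `(2,0)`-class), granted a marking (for the type-preservation).
[cite: Huybrechts2019, Cor. 0.4 (ii) and Rem. 3.3] [cite: Huybrechts2016K3, Ch. 3 Thm. 3.7] -/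
theorem hasComplexMultiplication_of_cmNorm (hmk : Huybrechts_K3_marking_exists) {S : SchemeOver ℂ}
    (hS : IsK3Surface S) {p : complexBetti S (2 * 2)} (hp : Gen[S, p]) (hcm : CMNorm2[S, p]) :
    HasComplexMultiplication S := by
  obtain ⟨e, he_rat, he_sim, σ, t, hσ, hσ0, htim, heσ⟩ := hcm
  exact ⟨e, he_rat, fun i j y hy => cmNorm_typePreserving hmk hS hp e he_rat he_sim hσ hσ0 heσ i j y hy,
    σ, t, hσ, hσ0, htim, heσ⟩

/-! ## A CM-norm-2 surface is its own anchor -/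

/-- **A CM-norm-2 projective K3 surface is its own algebraic `2`-anchor** (`OutAnchor[μ, S, S, …]` with
`Ψ := e`): `e` is bijective (a `2`-similitude of the non-degenerate K3 form, through a marking), ALGEBRAIC —
`e = η⁻¹ ∘ J ∘ η = [γ_e]_*` with `γ_e ∈ N²H⁴(S × S)` by the landed anchor theorem
`CmNormAnchors.stub_cmSelfSimilitude_algebraic` (Buskin's CM corollary; de Rham's theorem and the Hodge
types of `H²(K3)` are theorems of the tree) — and its inverse is rational, type-preserving and HALVES the
cup form: the equivalence `Φ` with `Φ⁻¹ = ½e` has a rational, type-preserving, halving inverse, so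
`Φ = 2e⁻¹` is rational, type-preserving and doubling (`stub_anchorForward`), i.e. `e⁻¹ = ½Φ` is rational,
type-preserving and halving. [cite: Buskin2019, Corollary (Introduction)] [cite: Huybrechts2019, Cor. 0.4 (ii)]
[cite: Varesco2023, §0.1] -/
theorem outAnchor_self_of_cmNorm (hmk : Huybrechts_K3_marking_exists)
    (hBCM : Buskin2019_hodgeConjectureFor_square_of_CM)
    {μ : OrientationFamily} (hμ : μ.HasPoincareDuality)
    {S : SchemeOver ℂ} (hS : IsK3Surface S) {p : complexBetti S (2 * 2)} (hp : Gen[S, p])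
    (hcm : CMNorm2[S, p]) : OutAnchor[μ, S, S, hS, hS, p, p] := by
  obtain ⟨e, he_rat, he_sim, σ, t, hσ, hσ0, htim, heσ⟩ := hcm
  obtain ⟨η, p₀, x₀, hp₀0, hm, hx⟩ := hmk S hS
  obtain ⟨hJrat, hJ2, hJx, hJe⟩ := cmNorm_markingConj hS hp η p₀ x₀ hm e he_rat he_sim hσ hσ0 heσ
  have he_typ : ∀ (i j : ℕ) x, IsOfHodgeType 2 S (2 * 1) i j x → IsOfHodgeType 2 S (2 * 1) i j (e x) :=
    cmNorm_typePreserving hmk hS hp e he_rat he_sim hσ hσ0 heσ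
  set J : Module.End ℂ (K3Index → ℂ) := η.toLinearMap ∘ₗ e ∘ₗ η.symm.toLinearMap with hJdef
  -- `J`, hence `e`, is bijective (a `2`-similitude of the non-degenerate K3 form)
  have hJinj : Function.Injective J := by
    refine (injective_iff_map_eq_zero J).2 fun a ha => k3Form_eq_zero_of_forall fun b => ?_
    have h := hJ2 a b
    rw [ha, k3Form_zero_left] at h
    exact (mul_eq_zero.1 h.symm).resolve_left two_ne_zero
  have hJsurj : Function.Surjective J := LinearMap.surjective_of_injective hJinj
  let Je : (K3Index → ℂ) ≃ₗ[ℂ] (K3Index → ℂ) := LinearEquiv.ofBijective J ⟨hJinj, hJsurj⟩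
  let E : complexBetti S (2 * 1) ≃ₗ[ℂ] complexBetti S (2 * 1) := η.trans (Je.trans η.symm)
  have hE : ∀ y, E y = e y := fun y => by
    show η.symm (Je (η y)) = e y
    rw [LinearEquiv.ofBijective_apply, hJe]
  -- `Φ := 2 · e⁻¹`, the equivalence with inverse `½ e`
  have hhalf : (((1 / 2 : ℚ) : ℂ)) = (2 : ℂ)⁻¹ := by push_cast; ring
  let f : complexBetti S (2 * 1) →ₗ[ℂ] complexBetti S (2 * 1) :=
    (2 : ℂ) • (E.symm : complexBetti S (2 * 1) →ₗ[ℂ] complexBetti S (2 * 1))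
  let g : complexBetti S (2 * 1) →ₗ[ℂ] complexBetti S (2 * 1) :=
    (((1 / 2 : ℚ) : ℂ)) • (E : complexBetti S (2 * 1) →ₗ[ℂ] complexBetti S (2 * 1))
  have hfg : ∀ y, f (g y) = y := fun y => by
    simp only [f, g, LinearMap.smul_apply, LinearEquiv.coe_coe, map_smul, LinearEquiv.symm_apply_apply,
      smul_smul, hhalf, inv_mul_cancel₀ (two_ne_zero' ℂ), one_smul]
  have hgf : ∀ x, g (f x) = x := fun x => by
    simp only [f, g, LinearMap.smul_apply, LinearEquiv.coe_coe, map_smul, LinearEquiv.apply_symm_apply,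
      smul_smul, hhalf, mul_inv_cancel₀ (two_ne_zero' ℂ), one_smul]
  let Φ : complexBetti S (2 * 1) ≃ₗ[ℂ] complexBetti S (2 * 1) :=
    LinearEquiv.ofLinear f g (LinearMap.ext hfg) (LinearMap.ext hgf)
  have hΦ : ∀ y, Φ y = (2 : ℂ) • E.symm y := fun y => rfl
  have hΦ' : ∀ y, Φ.symm y = (((1 / 2 : ℚ) : ℂ)) • e y := fun y => by
    show g y = _
    simp only [g, LinearMap.smul_apply, LinearEquiv.coe_coe, hE]
  -- `Φ⁻¹ = ½ e` is rational, type-preserving and halving, so `Φ = 2 e⁻¹` is rational,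
  -- type-preserving and doubling (`stub_anchorForward`)
  have hr : ∀ y, IsRationalClass y → IsRationalClass (Φ.symm y) := fun y hy => by
    rw [hΦ']
    exact (he_rat y hy).smul (1 / 2 : ℚ)
  have ht : ∀ (i j : ℕ) y, IsOfHodgeType 2 S (2 * 1) i j y →
      IsOfHodgeType 2 S (2 * 1) i j (Φ.symm y) := fun i j y hy => by
    rw [hΦ']
    exact (he_typ i j y hy).smul _
  have hs : ∀ (u v : complexBetti S (2 * 1)) (b : ℂ),
      cupProduct (rfl : 2 * 1 + 2 * 1 = 2 * 2) u v = ((2 : ℂ) * b) • p →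
        cupProduct (rfl : 2 * 1 + 2 * 1 = 2 * 2) (Φ.symm u) (Φ.symm v) = b • p := by
    intro u v b huv
    rw [hΦ', hΦ']
    simp only [map_smul, LinearMap.smul_apply]
    rw [he_sim u v ((2 : ℂ) * b) huv, smul_smul, smul_smul, hhalf]
    congr 1
    ring
  obtain ⟨hΦr, hΦt, hΦs⟩ := stub_anchorForward hmk S S hS hS p p hp hp Φ hr ht hs
  have hEs : ∀ z, E.symm z = (((1 / 2 : ℚ) : ℂ)) • Φ z := fun z => by
    rw [hΦ, smul_smul, hhalf, inv_mul_cancel₀ (two_ne_zero' ℂ), one_smul]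
  -- `e = [γ_e]_*` is algebraic: the anchor theorem of the CM-norm line (Buskin's CM corollary)
  obtain ⟨γ, hγ, hJγ⟩ := CmNormAnchors.stub_cmSelfSimilitude_algebraic
    (fun F _ _ _ => exists_deRhamIsoFamily_holds (E := F)) hBCM Huybrechts_K3_hodgeTypes_H2_holds 2 two_ne_zero J
    hJrat hJ2 x₀ t htim hJx μ hμ S hS η p₀ hm hx
  refine ⟨E, ?_, ?_, ?_, γ, hγ, fun x => ?_⟩
  · intro y hy
    rw [hEs]
    exact (hΦr y hy).smul (1 / 2 : ℚ)
  · intro i j y hy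
    rw [hEs]
    exact (hΦt i j y hy).smul _
  · intro u v b huv
    rw [hEs, hEs]
    simp only [map_smul, LinearMap.smul_apply]
    rw [hΦs u v ((2 : ℂ) * b) huv, smul_smul, smul_smul, hhalf]
    congr 1
    ring
  · rw [hE, ← hJe]
    exact hJγ x

/-- Registered anchor of this file (stub `cmNormSelfAnchor_anchor` on the crux item; closed form of
`outAnchor_self_of_cmNorm`): a CM-norm-2 projective K3 surface is its own algebraic `2`-anchor, granted K3
markings and Buskin's CM corollary. [cite: Buskin2019, Corollary (Introduction)] [cite: Huybrechts2019, Cor. 0.4 (ii)] -/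
theorem cmNormSelfAnchor_anchor :
    Huybrechts_K3_marking_exists → Buskin2019_hodgeConjectureFor_square_of_CM →
    ∀ (μ : OrientationFamily), μ.HasPoincareDuality →
      ∀ (S : SchemeOver ℂ) (hS : IsK3Surface S) (p : complexBetti S (2 * 2)), Gen[S, p] → CMNorm2[S, p] →
        OutAnchor[μ, S, S, hS, hS, p, p] :=
  fun hmk hBCM _ hμ _ hS _ hp hcm => outAnchor_self_of_cmNorm hmk hBCM hμ hS hp hcm

end Summit.HodgeConjecture.HodgeConjecture.Theorems.NikulinTwinTransport

end
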